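import Literature.Geometry.Lorentzian.IMCFSecondFundamentalFormEvolution
import Literature.Geometry.Lorentzian.TracedGaussEquation
import Literature.Geometry.Lorentzian.GerochMonotonicityEvolution
import Literature.Analysis.Calculus.MatrixFieldDeriv
import HarnessLib

/-!
# The evolution equation (1.3) of the mean curvature under inverse mean curvature flow

For a classical solution `F` of inverse mean curvature flow by a surface in a Riemannian
`3`-manifold (`IsClassicalIMCF`, Huisken–Ilmanen 2001, §0 (∗): `∂_t F = H⁻¹ ν`), the mean
curvature satisfies Huisken–Ilmanen's evolution equation (1.3),
`∂H/∂t = −Δ(H⁻¹) − |A|²/H − Rc(ν,ν)/H`: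

* `IsClassicalIMCF.hasDerivAt_meanCurvature` — at every `t₀ ∈ (a, b)` and `p ∈ S`, the function
  `t ↦ H(t, p)` has derivative `−Δ_{g_{t₀}}(H⁻¹)(p) − (|A|²(p) + Rc_h(ν,ν)(F_{t₀} p))/H(t₀, p)`;
* `geroch_monotonicity_smooth_of_gaussBonnet` — consequently the named fact
  `geroch_monotonicity_smooth` (Huisken–Ilmanen 2001, §5, Geroch Monotonicity, smooth case)
  follows from the Gauss–Bonnet bound `∫_{N_t} R(g_t) dμ_t ≤ 8π` alone: every analytic step of
  the printed Monotonicity Calculation is now a theorem of the tree.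

The proof of (1.3) differentiates `H = ∑ (𝒢⁻¹)_{ca} K(β_a, β_c)` in an `(F_{t₀}^*h)`-orthogonal
basis `β` of `T_p S`: `∂_t 𝒢 = H⁻¹ (K + Kᵀ)` (`InverseMeanCurvatureFlowArea.hasDerivAt_val_mfderiv`,
(1.1)), `∂_t 𝒢⁻¹ = −𝒢⁻¹ ∂_t𝒢 𝒢⁻¹` (`MatrixFieldDeriv.hasFDerivAt_inv_apply`), and the evolution
of `K` (`IMCFSecondFundamentalFormEvolution.hasDerivAt_secondFundamentalForm`); the traces at `t₀`
are computed in the orthogonal frame (`ricci_eq_of_isOrthoᵢ_three`, `normSq_eq_sum_sq`,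
`val_normalDerivAlong_self_eq`).

Everything is proved; there are no definitions and no named facts.

## References

* G. Huisken, T. Ilmanen, *The inverse mean curvature flow and the Riemannian Penrose
  inequality*, J. Differential Geom. 59 (2001) 353–437: §1, (1.1)–(1.3); §5, Monotonicity
  Calculation.
* G. Huisken, A. Polden, *Geometric evolution equations for hypersurfaces*, LNM 1713 (1999),
  Thm. 3.2.
* B. O'Neill, *Semi-Riemannian geometry*, Academic Press 1983, Ch. 3, Lemma 3.52; Ch. 4,
  Lemma 4.19.
-/

noncomputable section

open Bundle Set Manifold TopologicalSpace Filter Function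
open scoped ContDiff Topology Manifold

namespace Literature.Geometry.Lorentzian

namespace PseudoRiemannianMetric

variable {E : Type*} [NormedAddCommGroup E] [NormedSpace ℝ E] {H : Type*} [TopologicalSpace H]
  {I : ModelWithCorners ℝ E H} {M : Type*} [TopologicalSpace M] [ChartedSpace H M]
  [IsManifold I ∞ M] [FiniteDimensional ℝ E] [CompleteSpace E]
  (g : PseudoRiemannianMetric I ∞ E (TangentSpace I : M → Type _)) [g.HasLeviCivita]

omit [CompleteSpace E] in
/-- **The Ricci curvature in an orthogonal frame of a three-manifold**: for an orthogonal basis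
`(β₀, β₁, β₂)` of non-null vectors, `Ric(β₂, β₂) = g(R(β₀,β₂)β₂, β₀)/g(β₀,β₀) +
g(R(β₁,β₂)β₂, β₁)/g(β₁,β₁)` (O'Neill 1983, Ch. 3, Lemma 3.52 with `g^{ii} = 1/g(βᵢ,βᵢ)`, and
`g(R(β₂,β₂)β₂, β₂) = 0`). [cite: ONeill1983, Ch. 3, Lemma 3.52] -/
theorem ricci_eq_of_isOrthoᵢ_three (x : M) (β : Module.Basis (Fin 3) ℝ (TangentSpace I x))
    (hβ : (g.toBilinForm x).IsOrthoᵢ β) (h0 : g.val x (β 0) (β 0) ≠ 0)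
    (h1 : g.val x (β 1) (β 1) ≠ 0) (h2 : g.val x (β 2) (β 2) ≠ 0) :
    g.ricci x (β 2) (β 2) =
      g.val x (g.riemann x (β 0) (β 2) (β 2)) (β 0) / g.val x (β 0) (β 0) +
        g.val x (g.riemann x (β 1) (β 2) (β 2)) (β 1) / g.val x (β 1) (β 1) := by
  rw [ricci_eq_sum g x β]
  simp only [gram_inv_of_isOrthoᵢ g x β hβ (by intro i; fin_cases i <;> assumption),
    Matrix.diagonal_apply, Fin.sum_univ_three, Fin.isValue, if_true, if_false, zero_mul, add_zero,
    zero_add, val_riemann_self₁₂, mul_zero,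
    show (1 : Fin 3) ≠ 0 from by decide, show (2 : Fin 3) ≠ 0 from by decide,
    show (2 : Fin 3) ≠ 1 from by decide, show (0 : Fin 3) ≠ 1 from by decide,
    show (0 : Fin 3) ≠ 2 from by decide, show (1 : Fin 3) ≠ 2 from by decide]
  field_simp

end PseudoRiemannianMetric

open PseudoRiemannianMetric

variable {X : Type*} [TopologicalSpace X] [ChartedSpace E3 X] [IsManifold (𝓡 3) ∞ X]
  {h : ContMDiffRiemannianMetric (𝓡 3) ∞ E3 (TangentSpace (𝓡 3) : X → Type _)}
  [(ofRiemannian h).HasLeviCivita]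
  {S : Type*} [TopologicalSpace S] [ChartedSpace (EuclideanSpace ℝ (Fin 2)) S]
  [IsManifold (𝓡 2) ∞ S] {hpb : contMDiff_pullbackBilin (𝓡 3) X (𝓡 2) S ∞}
  {F : ℝ → S → X} {ν : (t : ℝ) → NormalField (𝓡 3) (F t)} {a b : ℝ}

namespace IsClassicalIMCF

/-- **`h(D_v ν, D_v ν)` in an orthogonal frame.** For a classical solution, `t ∈ (a, b)`, `p ∈ S`,
an `(F_t^* h)`-orthogonal basis `(β₀, β₁)` of `T_p S` with `aₖ = (F_t^*h)(βₖ, βₖ) ≠ 0`, and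
`v ∈ T_p S`: `h(D_v ν, D_v ν) = K(v, β₀)²/a₀ + K(v, β₁)²/a₁` — `D_v ν` is tangential
(`val_normal_normalDerivAlong`) with `h(D_v ν, dF u) = K(v, u)`
(`secondFundamentalForm_apply_holds`), so `D_v ν = dF(∑ₖ K(v, βₖ)/aₖ · βₖ)`
(`val_eq_inducedMetric_add_normal`). O'Neill 1983, Ch. 4, Lemma 4.19 ff. [cite: ONeill1983, Ch. 4,
Lemma 4.19] -/
theorem val_normalDerivAlong_self_eq (Hc : IsClassicalIMCF h hpb F ν a b) {t : ℝ}
    (ht : t ∈ Set.Ioo a b) (p : S) (β : Module.Basis (Fin 2) ℝ (TangentSpace (𝓡 2) p))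
    (hβ : (((ofRiemannian h).inducedMetric (F t) hpb (Hc.isSpacelikeImmersion t ht)).toBilinForm
      p).IsOrthoᵢ β)
    (hd : ∀ k, ((ofRiemannian h).inducedMetric (F t) hpb (Hc.isSpacelikeImmersion t ht)).val p
      (β k) (β k) ≠ 0) (v : TangentSpace (𝓡 2) p) :
    (ofRiemannian h).val (F t p) ((ofRiemannian h).normalDerivAlong (F t) (ν t) p v)
        ((ofRiemannian h).normalDerivAlong (F t) (ν t) p v) =
      (ofRiemannian h).secondFundamentalForm (𝓡 2) (F t) (ν t) p v (β 0) ^ 2 /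
          ((ofRiemannian h).inducedMetric (F t) hpb (Hc.isSpacelikeImmersion t ht)).val p
            (β 0) (β 0) +
        (ofRiemannian h).secondFundamentalForm (𝓡 2) (F t) (ν t) p v (β 1) ^ 2 /
          ((ofRiemannian h).inducedMetric (F t) hpb (Hc.isSpacelikeImmersion t ht)).val p
            (β 1) (β 1) := by
  set g := ofRiemannian h with hg
  set gN := g.inducedMetric (F t) hpb (Hc.isSpacelikeImmersion t ht) with hgN
  set N : TangentSpace (𝓡 3) (F t p) := g.normalDerivAlong (F t) (ν t) p v with hN
  set K : LinearMap.BilinForm ℝ (TangentSpace (𝓡 2) p) :=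
    g.secondFundamentalForm (𝓡 2) (F t) (ν t) p with hK
  have hKapply : ∀ u, K v u = g.val (F t p) N (mfderiv (𝓡 2) (𝓡 3) (F t) p u) := fun u ↦
    secondFundamentalForm_apply_holds (g := g) (I' := 𝓡 2) BoundarylessManifold.isInteriorPoint
      (((Hc.contMDiff_normal t ht) p).mdifferentiableAt (by simp)) v u
  have h01 : gN.val p (β 0) (β 1) = 0 := hβ (show (0 : Fin 2) ≠ 1 by decide)
  have h10 : gN.val p (β 1) (β 0) = 0 := hβ (show (1 : Fin 2) ≠ 0 by decide)
  -- the tangential part of `N`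
  set aN : TangentSpace (𝓡 2) p := (K v (β 0) / gN.val p (β 0) (β 0)) • β 0 +
    (K v (β 1) / gN.val p (β 1) (β 1)) • β 1 with haN
  have haNβ : ∀ k, gN.val p aN (β k) = K v (β k) := by
    have ha0 := hd 0
    have ha1 := hd 1
    intro k
    fin_cases k
    · simp only [haN, map_add, map_smul, _root_.add_apply, _root_.smul_apply, smul_eq_mul, h10,
        Fin.zero_eta, Fin.isValue, mul_zero, add_zero]
      field_simp
    · simp only [haN, map_add, map_smul, _root_.add_apply, _root_.smul_apply, smul_eq_mul, h01,
        Fin.mk_one, Fin.isValue, mul_zero, zero_add]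
      field_simp
  have hA : ∀ u : TangentSpace (𝓡 2) p, g.val (F t p) N (mfderiv (𝓡 2) (𝓡 3) (F t) p u) =
      gN.val p aN u := by
    -- two linear functionals agreeing on the basis `β`
    have hlin : ((g.val (F t p) N).comp (mfderiv (𝓡 2) (𝓡 3) (F t) p)).toLinearMap =
        (gN.val p aN).toLinearMap := by
      refine β.ext fun k ↦ ?_
      simp only [ContinuousLinearMap.coe_coe, ContinuousLinearMap.coe_comp, Function.comp_apply,
        haNβ k, hKapply]
    intro u
    exact congrArg (fun L : TangentSpace (𝓡 2) p →ₗ[ℝ] ℝ ↦ L u) hlin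
  have hdim : Module.finrank ℝ E3 = Module.finrank ℝ (EuclideanSpace ℝ (Fin 2)) + 1 := by
    simp [E3]
  have key := val_eq_inducedMetric_add_normal g hpb (Hc.isSpacelikeImmersion t ht) (y := p)
    (νy := ν t p) (A := N) (B := N) (a := aN) (b := aN) (ε := 1)
    (fun u ↦ (Hc.isUnitNormal t ht).isNormalTo p u) ((Hc.isUnitNormal t ht).val_self p)
    one_ne_zero hdim hA hA
  rw [key, g.symm (F t p) N (ν t p)]
  change gN.val p aN aN + g.val (F t p) (ν t p) (g.normalDerivAlong (F t) (ν t) p v) *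
    g.val (F t p) (ν t p) (g.normalDerivAlong (F t) (ν t) p v) / 1 = _
  rw [Hc.val_normal_normalDerivAlong ht p v, mul_zero, zero_div, add_zero]
  have ha0 := hd 0
  have ha1 := hd 1
  simp only [haN, map_add, map_smul, _root_.add_apply, _root_.smul_apply, smul_eq_mul, h01, h10]
  field_simp
  ring

set_option maxHeartbeats 800000 in
/-- **The evolution equation (1.3) of the mean curvature** (Huisken–Ilmanen 2001, §1, (1.3):
`∂H/∂t = −Δ(H⁻¹) − (|A|² + Rc(ν,ν))/H`). For a classical solution of inverse mean curvature flow
by a surface in a Riemannian `3`-manifold, `t₀ ∈ (a, b)` and `p ∈ S`, the mean curvature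
`t ↦ H(t, p)` (extended by `0` off `(a, b)`) has derivative
`−Δ_{g_{t₀}}(H_{t₀}⁻¹)(p) − (|A|²_{g_{t₀}}(p) + Rc_h(ν, ν)(F_{t₀} p))/H(t₀, p)` at `t₀`. Proof: in
an `(F_{t₀}^*h)`-orthogonal basis `β` of `T_p S`, `H(t) = ∑ (𝒢(t)⁻¹)_{ca} K_t(β_a, β_c)`
(`trace_eq_sum_gram_inv`) with `𝒢_{ac}(t) = h(dF_t β_a, dF_t β_c)`; differentiate with
`∂_t 𝒢 = H⁻¹(K + Kᵀ)` (`hasDerivAt_val_mfderiv`), `∂_t 𝒢⁻¹ = −𝒢⁻¹ (∂_t 𝒢) 𝒢⁻¹`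
(`hasFDerivAt_inv_apply`) and the evolution of `K` (`hasDerivAt_secondFundamentalForm`); at `t₀`,
`𝒢 = diag(aₖ)`, and the traces are `Δ(H⁻¹) = ∑ Hess(βₖ,βₖ)/aₖ`, `|A|² = ∑ K(βₖ,βₗ)²/(aₖaₗ)`
(`normSq_eq_sum_sq`), `Rc(ν,ν) = ∑ h(R(dFβₖ,ν)ν, dFβₖ)/aₖ` (`ricci_eq_of_isOrthoᵢ_three` in the
adapted basis `(dF β₀, dF β₁, ν)`), `h(D_{βₖ}ν, D_{βₖ}ν) = ∑ₗ K(βₖ,βₗ)²/aₗ`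
(`val_normalDerivAlong_self_eq`). [cite: HuiskenIlmanenIMCF2001, §1 (1.3)] -/
theorem hasDerivAt_meanCurvature (Hc : IsClassicalIMCF h hpb F ν a b) {t₀ : ℝ}
    (ht₀ : t₀ ∈ Set.Ioo a b) (p : S) :
    haveI := ((ofRiemannian h).inducedMetric (F t₀) hpb (Hc.isSpacelikeImmersion t₀
        ht₀)).hasLeviCivita
    HasDerivAt (fun t ↦ if ht : t ∈ Set.Ioo a b then
        (ofRiemannian h).meanCurvature (F t) hpb (Hc.isSpacelikeImmersion t ht) (ν t) p else 0)
      (-((ofRiemannian h).inducedMetric (F t₀) hpb (Hc.isSpacelikeImmersion t₀ ht₀)).dalembertian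
          (fun z ↦ ((ofRiemannian h).meanCurvature (F t₀) hpb (Hc.isSpacelikeImmersion t₀ ht₀)
            (ν t₀) z)⁻¹) p -
        (((ofRiemannian h).inducedMetric (F t₀) hpb (Hc.isSpacelikeImmersion t₀ ht₀)).normSq p
            ((ofRiemannian h).secondFundamentalForm (𝓡 2) (F t₀) (ν t₀) p) +
          (ofRiemannian h).ricci (F t₀ p) (ν t₀ p) (ν t₀ p)) /
        (ofRiemannian h).meanCurvature (F t₀) hpb (Hc.isSpacelikeImmersion t₀ ht₀) (ν t₀) p) t₀ :=
            by
  set g := ofRiemannian h with hg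
  set gN := g.inducedMetric (F t₀) hpb (Hc.isSpacelikeImmersion t₀ ht₀) with hgN
  haveI := gN.hasLeviCivita
  have hLC := isLeviCivita_leviCivita_holds (g := g)
  have h3 : Module.finrank ℝ E3 = 3 := by simp [E3]
  have hF2 : ContMDiff (𝓡 2) (𝓡 3) 2 (F t₀) :=
    (Hc.isSpacelikeImmersion t₀ ht₀).contMDiff_self.of_le (by exact WithTop.coe_le_coe.2 le_top)
  -- an orthogonal basis `β` of `(T_p S, F_{t₀}^* h)`
  obtain ⟨e, he, hd⟩ := exists_isOrthoᵢ_basis gN p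
  have hfin : Module.finrank ℝ (TangentSpace (𝓡 2) p) = 2 := by
    show Module.finrank ℝ (EuclideanSpace ℝ (Fin 2)) = 2; simp
  set β : Module.Basis (Fin 2) ℝ (TangentSpace (𝓡 2) p) := e.reindex (finCongr hfin) with hβdef
  have hβapply : ∀ k, β k = e ((finCongr hfin).symm k) := fun k ↦ Module.Basis.reindex_apply _ _ _
  have hβ : (gN.toBilinForm p).IsOrthoᵢ β := by
    intro k l hkl
    simp only [Function.onFun, hβapply]
    exact he fun h ↦ hkl ((finCongr hfin).symm.injective h)
  have hdβ : ∀ k, gN.val p (β k) (β k) ≠ 0 := fun k ↦ by rw [hβapply]; exact hd _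
  have h01 : gN.val p (β 0) (β 1) = 0 := hβ (show (0 : Fin 2) ≠ 1 by decide)
  have h10 : gN.val p (β 1) (β 0) = 0 := hβ (show (1 : Fin 2) ≠ 0 by decide)
  -- the Gram coefficients and the second fundamental form along the flow, in the basis `β`
  set G : ℝ → Fin 2 → Fin 2 → ℝ := fun t i j ↦ g.val (F t p) (mfderiv (𝓡 2) (𝓡 3) (F t) p (β i))
    (mfderiv (𝓡 2) (𝓡 3) (F t) p (β j)) with hGdef
  set K : ℝ → Fin 2 → Fin 2 → ℝ := fun t i j ↦ g.secondFundamentalForm (𝓡 2) (F t) (ν t) p (β i)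
    (β j) with hKdef
  -- (1) `H = ∑ (𝒢⁻¹)_{ji} K_{ij}` near `t₀`
  have hformula : (fun t ↦ if ht : t ∈ Set.Ioo a b then
      g.meanCurvature (F t) hpb (Hc.isSpacelikeImmersion t ht) (ν t) p else 0) =ᶠ[𝓝 t₀]
      fun t ↦ ∑ i, ∑ j, (Matrix.of (G t))⁻¹ j i * K t i j := by
    filter_upwards [isOpen_Ioo.mem_nhds ht₀] with t ht
    rw [dif_pos ht, meanCurvature, trace_eq_sum_gram_inv _ p β]
    rfl
  -- (2a) derivative of the Gram coefficients: `∂_t 𝒢_{ij} = H⁻¹ (K_{ij} + K_{ji})`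
  have hNK : ∀ (v u : TangentSpace (𝓡 2) p), g.val (F t₀ p) (g.normalDerivAlong (F t₀) (ν t₀) p v)
      (mfderiv (𝓡 2) (𝓡 3) (F t₀) p u) = g.secondFundamentalForm (𝓡 2) (F t₀) (ν t₀) p v u :=
    fun v u ↦ (secondFundamentalForm_apply_holds (g := g) (I' := 𝓡 2)
      BoundarylessManifold.isInteriorPoint
      (((Hc.contMDiff_normal t₀ ht₀) p).mdifferentiableAt (by simp)) v u).symm
  have hG : ∀ i j, HasDerivAt (fun t ↦ G t i j)
      ((g.meanCurvature (F t₀) hpb (Hc.isSpacelikeImmersion t₀ ht₀) (ν t₀) p)⁻¹ *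
        (K t₀ i j + K t₀ j i)) t₀ := fun i j ↦ by
    have h1 := Hc.hasDerivAt_val_mfderiv ht₀ p (β i) (β j)
    rw [hNK, hNK] at h1
    exact h1
  have hGpi : HasDerivAt G (fun i j ↦
      (g.meanCurvature (F t₀) hpb (Hc.isSpacelikeImmersion t₀ ht₀) (ν t₀) p)⁻¹ *
        (K t₀ i j + K t₀ j i)) t₀ :=
    hasDerivAt_pi.2 fun i ↦ hasDerivAt_pi.2 fun j ↦ hG i j
  -- (2b) the Gram matrix at `t₀` is `diag(aₖ)`, hence invertible
  have hG0 : Matrix.of (G t₀) = Matrix.diagonal fun k ↦ gN.val p (β k) (β k) := by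
    ext i j
    fin_cases i <;> fin_cases j
    · rfl
    · exact h01
    · exact h10
    · rfl
  have hG0inv : (Matrix.of (G t₀))⁻¹ = Matrix.diagonal fun k ↦ (gN.val p (β k) (β k))⁻¹ :=
    gram_inv_of_isOrthoᵢ gN p β hβ hdβ
  have hdet : (Matrix.of (G t₀)).det ≠ 0 := by
    rw [hG0, Matrix.det_diagonal, Fin.prod_univ_two]
    exact mul_ne_zero (hdβ 0) (hdβ 1)
  -- (2c) derivative of the inverse Gram matrix
  have hGinv : ∀ j i, HasDerivAt (fun t ↦ (Matrix.of (G t))⁻¹ j i)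
      (-∑ k, ∑ l, (Matrix.of (G t₀))⁻¹ j k * (Matrix.of (G t₀))⁻¹ l i *
        ((g.meanCurvature (F t₀) hpb (Hc.isSpacelikeImmersion t₀ ht₀) (ν t₀) p)⁻¹ *
          (K t₀ k l + K t₀ l k))) t₀ := fun j i ↦ by
    have h1 := (Literature.Analysis.Calculus.hasFDerivAt_inv_apply hGpi.hasFDerivAt hdet j
        i).hasDerivAt
    refine h1.congr_deriv ?_
    simp only [_root_.neg_apply, FunLike.coe_sum, Finset.sum_apply, FunLike.coe_smul,
      Pi.smul_apply, ContinuousLinearMap.coe_comp, Function.comp_apply,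
      ContinuousLinearMap.proj_apply, smul_eq_mul,
      ContinuousLinearMap.toSpanSingleton_apply, one_smul]
  -- (2d) derivative of `K`
  have hK : ∀ i j, HasDerivAt (fun t ↦ K t i j)
      (-(gN.hessian (fun y ↦ (g.meanCurvature (F t₀) hpb (Hc.isSpacelikeImmersion t₀ ht₀)
          (ν t₀) y)⁻¹) p (β i) (β j)) +
        (g.meanCurvature (F t₀) hpb (Hc.isSpacelikeImmersion t₀ ht₀) (ν t₀) p)⁻¹ *
          g.val (F t₀ p) (g.leviCivita.curvature (F t₀ p) (ν t₀ p)
            (mfderiv (𝓡 2) (𝓡 3) (F t₀) p (β i)) (ν t₀ p)) (mfderiv (𝓡 2) (𝓡 3) (F t₀) p (β j)) +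
        (g.meanCurvature (F t₀) hpb (Hc.isSpacelikeImmersion t₀ ht₀) (ν t₀) p)⁻¹ *
          g.val (F t₀ p) (g.normalDerivAlong (I' := 𝓡 2) (F t₀) (ν t₀) p (β i))
            (g.normalDerivAlong (I' := 𝓡 2) (F t₀) (ν t₀) p (β j))) t₀ := fun i j ↦
    Hc.hasDerivAt_secondFundamentalForm ht₀ p β i j
  -- (2e) derivative of the double sum
  have hsum := HasDerivAt.fun_sum (u := Finset.univ) fun i _ ↦
    HasDerivAt.fun_sum (u := Finset.univ) fun j _ ↦ (hGinv j i).mul (hK i j)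
  refine (hsum.congr_of_eventuallyEq hformula).congr_deriv ?_
  -- (3) the algebra at `t₀`, where `𝒢 = diag(aₖ)`
  -- symmetry of `K`
  have hKs : K t₀ 1 0 = K t₀ 0 1 :=
    (secondFundamentalForm_symm_holds (g := g) (I' := 𝓡 2) hF2 (Hc.isUnitNormal t₀ ht₀).isNormalTo
      ((Hc.contMDiff_normal t₀ ht₀).of_le (by exact WithTop.coe_le_coe.2 le_top))
      BoundarylessManifold.isInteriorPoint).eq _ _
  -- the Laplacian in the frame
  have hΔ : gN.dalembertian (fun y ↦ (g.meanCurvature (F t₀) hpb (Hc.isSpacelikeImmersion t₀ ht₀)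
      (ν t₀) y)⁻¹) p =
      gN.hessian (fun y ↦ (g.meanCurvature (F t₀) hpb (Hc.isSpacelikeImmersion t₀ ht₀) (ν t₀) y)⁻¹)
          p (β 0) (β 0) / gN.val p (β 0) (β 0) +
        gN.hessian (fun y ↦ (g.meanCurvature (F t₀) hpb (Hc.isSpacelikeImmersion t₀ ht₀)
          (ν t₀) y)⁻¹) p (β 1) (β 1) / gN.val p (β 1) (β 1) := by
    rw [dalembertian, trace_eq_sum_gram_inv _ p β, gram_inv_of_isOrthoᵢ _ p β hβ hdβ]
    simp only [Matrix.diagonal_apply, Fin.sum_univ_two, Fin.isValue, if_true, one_ne_zero,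
      zero_ne_one, if_false, zero_mul, add_zero, zero_add]
    field_simp
  -- `|A|²` in the frame
  have hA := normSq_eq_sum_sq gN p β hβ hdβ (g.secondFundamentalForm (𝓡 2) (F t₀) (ν t₀) p)
  simp only [Fin.sum_univ_two, Fin.isValue] at hA
  -- `h(D_{βₖ}ν, D_{βₖ}ν)` in the frame
  have hNN : ∀ k, g.val (F t₀ p) (g.normalDerivAlong (I' := 𝓡 2) (F t₀) (ν t₀) p (β k))
      (g.normalDerivAlong (I' := 𝓡 2) (F t₀) (ν t₀) p (β k)) =
      K t₀ k 0 ^ 2 / gN.val p (β 0) (β 0) + K t₀ k 1 ^ 2 / gN.val p (β 1) (β 1) := fun k ↦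
    Hc.val_normalDerivAlong_self_eq ht₀ p β hβ hdβ (β k)
  -- `Rc(ν,ν)` in the adapted orthogonal basis `(dF β₀, dF β₁, ν)` of `T_{F p} X`
  have hn0 : ∀ k, g.val (F t₀ p) (mfderiv (𝓡 2) (𝓡 3) (F t₀) p (β k)) (ν t₀ p) = 0 := fun k ↦ by
    rw [g.symm]; exact (Hc.isUnitNormal t₀ ht₀).isNormalTo p (β k)
  have hg01 : g.val (F t₀ p) (mfderiv (𝓡 2) (𝓡 3) (F t₀) p (β 0))
      (mfderiv (𝓡 2) (𝓡 3) (F t₀) p (β 1)) = 0 := h01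
  have hg10 : g.val (F t₀ p) (mfderiv (𝓡 2) (𝓡 3) (F t₀) p (β 1))
      (mfderiv (𝓡 2) (𝓡 3) (F t₀) p (β 0)) = 0 := h10
  have hνε : g.val (F t₀ p) (ν t₀ p) (ν t₀ p) = 1 := (Hc.isUnitNormal t₀ ht₀).val_self p
  set v : Fin 3 → TangentSpace (𝓡 3) (F t₀ p) :=
    ![mfderiv (𝓡 2) (𝓡 3) (F t₀) p (β 0), mfderiv (𝓡 2) (𝓡 3) (F t₀) p (β 1), ν t₀ p] with hv
  have hv0 : v 0 = mfderiv (𝓡 2) (𝓡 3) (F t₀) p (β 0) := rfl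
  have hv1 : v 1 = mfderiv (𝓡 2) (𝓡 3) (F t₀) p (β 1) := rfl
  have hv2 : v 2 = ν t₀ p := rfl
  have hvo : (g.toBilinForm (F t₀ p)).IsOrthoᵢ v := by
    intro k l hkl
    fin_cases k <;> fin_cases l <;> first
      | exact absurd rfl hkl
      | simp only [Function.onFun, hv0, hv1, hv2, Fin.zero_eta, Fin.mk_one, Fin.reduceFinMk,
          toBilinForm_apply, hg01, hg10, hn0,
          g.symm (F t₀ p) (ν t₀ p) (mfderiv (𝓡 2) (𝓡 3) (F t₀) p (β _))]
  have hvd : ∀ k, g.toBilinForm (F t₀ p) (v k) (v k) ≠ 0 := by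
    intro k
    fin_cases k
    · simp only [hv0, Fin.zero_eta, Fin.isValue, toBilinForm_apply]; exact hdβ 0
    · simp only [hv1, Fin.mk_one, Fin.isValue, toBilinForm_apply]; exact hdβ 1
    · simp only [hv2, Fin.reduceFinMk, toBilinForm_apply, hνε]; exact one_ne_zero
  have hli : LinearIndependent ℝ v := LinearMap.linearIndependent_of_isOrthoᵢ hvo hvd
  haveI : FiniteDimensional ℝ (TangentSpace (𝓡 3) (F t₀ p)) :=
    inferInstanceAs (FiniteDimensional ℝ E3)
  have hcard : Fintype.card (Fin 3) = Module.finrank ℝ (TangentSpace (𝓡 3) (F t₀ p)) := by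
    show Fintype.card (Fin 3) = Module.finrank ℝ E3
    rw [h3, Fintype.card_fin]
  set γ := basisOfLinearIndependentOfCardEqFinrank hli hcard with hγdef
  have hγ : ∀ k, γ k = v k := fun k ↦
    congrFun (coe_basisOfLinearIndependentOfCardEqFinrank hli hcard) k
  have hγo : (g.toBilinForm (F t₀ p)).IsOrthoᵢ γ := by
    intro k l hkl
    simp only [Function.onFun, hγ]
    exact hvo hkl
  have hRic := ricci_eq_of_isOrthoᵢ_three g (F t₀ p) γ hγo
    (by rw [hγ]; exact hvd 0) (by rw [hγ]; exact hvd 1) (by rw [hγ]; exact hvd 2)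
  simp only [hγ, hv0, hv1, hv2] at hRic
  -- the curvature terms of `∂_t K`: `h(R(ν, dFβₖ)ν, dFβₖ) = -h(R(dFβₖ, ν)ν, dFβₖ)`
  have hRsw : ∀ k, g.val (F t₀ p) (g.leviCivita.curvature (F t₀ p) (ν t₀ p)
      (mfderiv (𝓡 2) (𝓡 3) (F t₀) p (β k)) (ν t₀ p)) (mfderiv (𝓡 2) (𝓡 3) (F t₀) p (β k)) =
      -g.val (F t₀ p) (g.riemann (F t₀ p) (mfderiv (𝓡 2) (𝓡 3) (F t₀) p (β k)) (ν t₀ p)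
        (ν t₀ p)) (mfderiv (𝓡 2) (𝓡 3) (F t₀) p (β k)) := fun k ↦
    val_curvature_antisymm (g := g) (cov := g.leviCivita) (F t₀ p) _ _ _ _
  -- the metric coefficients `aₖ = g(dF βₖ, dF βₖ)`
  have ha : ∀ k, g.val (F t₀ p) (mfderiv (𝓡 2) (𝓡 3) (F t₀) p (β k))
      (mfderiv (𝓡 2) (𝓡 3) (F t₀) p (β k)) = gN.val p (β k) (β k) := fun k ↦ rfl
  rw [ha 0, ha 1] at hRic
  -- expand everything
  rw [hG0inv]
  simp only [Matrix.diagonal_apply, Fin.sum_univ_two, Fin.isValue, if_true, one_ne_zero,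
    zero_ne_one, if_false, zero_mul, mul_zero, add_zero, zero_add, hRsw, hNN, hKs, Fin.isValue]
  rw [hΔ, hA, hRic]
  have ha0 := hdβ 0
  have ha1 := hdβ 1
  have hH0 : g.meanCurvature (F t₀) hpb (Hc.isSpacelikeImmersion t₀ ht₀) (ν t₀) p ≠ 0 :=
    (Hc.meanCurvature_pos t₀ ht₀ p).ne'
  have hKs' : g.secondFundamentalForm (𝓡 2) (F t₀) (ν t₀) p (β 1) (β 0) =
      g.secondFundamentalForm (𝓡 2) (F t₀) (ν t₀) p (β 0) (β 1) := hKs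
  simp only [hKdef, ← hg, hKs', Fin.isValue]
  field_simp
  ring

end IsClassicalIMCF

open MeasureTheory in
/-- **`geroch_monotonicity_smooth` from Gauss–Bonnet alone.** The named fact
`geroch_monotonicity_smooth` — monotonicity of the Hawking mass along a classical inverse mean
curvature flow of compact connected surfaces in a Riemannian `3`-manifold of non-negative scalar
curvature (Huisken–Ilmanen 2001, §5, Monotonicity Calculation, smooth case) — follows from the
single remaining topological input of the printed proof: the **Gauss–Bonnet bound**
`∫_{N_t} R(g_t) dμ_t ≤ 8π` for the leaves `N_t = (S, F_t^* h)` (`R = 2K` for surfaces, and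
`∫ K = 2πχ(N_t) ≤ 4π` since `N_t` is connected). Every other step of the printed proof is a
theorem of the tree: the evolution equation (1.3) of the mean curvature
(`IsClassicalIMCF.hasDerivAt_meanCurvature`), the joint regularity of `H`
(`IMCFRegularity.lean`), the first variation of area (1.1) and the differentiation of
`∫ H² dμ_t` (`GerochMonotonicityVariation.lean`), the Gauss equation
(`GerochMonotonicityGauss.lean`), the integration by parts `∫ H Δ(H⁻¹) ≥ 0`
(`GreenIdentity.lean`, `GerochMonotonicityProofs.lean`) and the final estimate
`2H² − 2|A|² ≤ H²`. [cite: HuiskenIlmanenIMCF2001, §5 Monotonicity Calculation (smooth case)] -/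
theorem geroch_monotonicity_smooth_of_gaussBonnet
    (hGB : ∀ (X : Type) [TopologicalSpace X] [ChartedSpace E3 X] [IsManifold (𝓡 3) ∞ X]
      [T2Space X] [SecondCountableTopology X]
      (h : ContMDiffRiemannianMetric (𝓡 3) ∞ E3 (TangentSpace (𝓡 3) : X → Type _))
      [(ofRiemannian h).HasLeviCivita]
      (S : Type) [TopologicalSpace S] [ChartedSpace (EuclideanSpace ℝ (Fin 2)) S]
      [IsManifold (𝓡 2) ∞ S] [CompactSpace S] [T2Space S] [ConnectedSpace S]
      [MeasurableSpace S] [BorelSpace S]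
      (hpb : contMDiff_pullbackBilin (𝓡 3) X (𝓡 2) S ∞)
      (F : ℝ → S → X) (ν : (t : ℝ) → NormalField (𝓡 3) (F t)) (a b : ℝ)
      (Hc : IsClassicalIMCF h hpb F ν a b) (t : ℝ) (ht : t ∈ Set.Ioo a b),
      haveI := ((ofRiemannian h).inducedMetric (F t) hpb (Hc.isSpacelikeImmersion t
          ht)).hasLeviCivita
      ∫ y, ((ofRiemannian h).inducedMetric (F t) hpb (Hc.isSpacelikeImmersion t
          ht)).scalarCurvature y
        ∂(riemannianVolume ((ofRiemannian h).inducedRiemannianMetric (F t) hpb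
          (Hc.isSpacelikeImmersion t ht)) 2) ≤ 8 * Real.pi) :
    geroch_monotonicity_smooth := by
  refine geroch_monotonicity_smooth_of_evolution' ?_
  intro X _ _ _ _ _ h _ S _ _ _ _ _ _ _ _ hpb F ν a b Hc _
  refine ⟨fun t y ↦ if ht : t ∈ Set.Ioo a b then
    (ofRiemannian h).meanCurvature (F t) hpb (Hc.isSpacelikeImmersion t ht) (ν t) y else 0,
    fun t ht y ↦ dif_pos ht, fun t ht y ↦ ?_, fun t ht ↦ hGB X h S hpb F ν a b Hc t ht⟩
  exact (Hc.hasDerivAt_meanCurvature ht y).deriv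

end Literature.Geometry.Lorentzian

end
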